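import Literature.Geometry.Lorentzian.LocalCauchyLens
import Literature.Geometry.Lorentzian.ChartCalculus
import HarnessLib

/-!
# Local Cauchy lenses with their shape: the explicit lens-shaped neighbourhoods over a level set
# of a time function, at every small radius

`LocalCauchyLens.lean` proves that a point `a` of a time-oriented Lorentzian manifold at which a
`C¹` function `f` (with `f a = 0`) has differential positive on the future causal cone has
arbitrarily small open neighbourhoods `V` in which the level set `{f = 0}` is a Cauchy
hypersurface (`LorentzianMetric.exists_isCauchyHypersurface_restrict_of_timeFunction`; the regions
`𝒰` of Hawking–Ellis 1973, §7.4, p. 234, Fig. 48, Lemma 7.4.4 (1)). Its proof produces `V`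
explicitly, in the chart `φ = extChartAt I a` at `a`, as
`V = φ⁻¹ {x : ‖x - φ a‖ < ρ' ∧ |f (φ⁻¹ x)| + k ‖x - φ a‖ < k ρ'/2}` for a slope `k > 0` and ALL
sufficiently small radii `ρ'`, but the statement only retains `∃ V`. This file re-runs the same
argument with the shape of `V` in the conclusion
(`exists_isCauchyHypersurface_restrict_lens_of_timeFunction`): **there are `k > 0` and `ρ₀ > 0`
such that for every `0 < ρ' ≤ ρ₀` the set `V(ρ')` above is an open neighbourhood of `a` inside
the prescribed `W` in which `S ∩ V(ρ')` is a Cauchy hypersurface.** The shape is what makes these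
lenses usable as the spacetimes of local Cauchy developments: `V(ρ')` is star-shaped about `a` in
the chart (hence connected), its trace on the level set is the chart-preimage of a ball when the
chart is adapted to `f` (`f ∘ φ⁻¹ = x⁰`), and two metrics on the same chart domain get lenses
over the SAME piece of the level set by taking a common `ρ'` — the form in which the local
uniqueness theorem is restarted from a spacelike piece of the boundary of a common development
(Sbierski 2016, §3.2, proof of Thm. 3.5 = arXiv Thm. 12: "suitable neighbourhoods of `S` in `M`
and of `ψ(S)` in `M'` are GHDs of `(S, ḡ_S, k_S)`").

For a chart domain `T : Opens E` of a normed space (where `extChartAt 𝓘(ℝ, E) a = Subtype.val`,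
`OpensChart.extChartAt_coe`) the lens is literally `{x ∈ T : ‖x - a‖ < ρ' ∧ |f x| + k‖x - a‖ < kρ'/2}`
(`exists_isCauchyHypersurface_restrict_lens_opens`).

Everything is proved (the proof of the main theorem is that of `LocalCauchyLens.lean`, verbatim up
to the bookkeeping of `k`, `ρ'`); no definitions, no named facts (D-0026).

## References

* S. W. Hawking, G. F. R. Ellis, *The large scale structure of space-time*, CUP 1973, §7.4,
  pp. 233–234 (the regions `𝒰`, `𝒰₊`, Fig. 48, Lemma 7.4.4 (1)). [HawkingEllis1973CUP]
* B. O'Neill, *Semi-Riemannian geometry with applications to relativity*, Academic Press 1983,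
  Ch. 14, Thm. 14.38 and Lemma 14.43 (pp. 423–426). [ONeillSemiRiemannian1983]
* J. Sbierski, Ann. Henri Poincaré 17 (2016) 301–329 = arXiv:1309.7591v3, §3.2, proof of Thm. 12
  (arXiv numbering). [Sbierski2016AHP]
-/

noncomputable section

open Bundle Set Filter Function Topology TopologicalSpace
open scoped Manifold ContDiff Topology

namespace Literature.Geometry.Lorentzian

variable {E : Type*} [NormedAddCommGroup E] [NormedSpace ℝ E] {H : Type*} [TopologicalSpace H]
  {I : ModelWithCorners ℝ E H} {n : ℕ∞ω} {M : Type*} [TopologicalSpace M] [ChartedSpace H M]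
  [IsManifold I ∞ M]

namespace LorentzianMetric

variable {g : LorentzianMetric I n M} {τ : TimeOrientation g}

/-- **Local Cauchy lenses, with their shape.** Let `(M, g, τ)` be a time-oriented `Cⁿ` (`n ≥ 1`)
Lorentzian manifold without boundary, of finite dimension, `a ∈ M`, and `f : M → ℝ` of class `C¹`
at `a` with `f a = 0` and `df_a(v) > 0` for every future-directed causal `v ∈ T_aM`. Let `S ⊆ M`
agree with `{f = 0}` near `a`, and let `W` be a neighbourhood of `a`. Then there are a slope `k > 0`
and a radius `ρ₀ > 0` such that for EVERY `0 < ρ' ≤ ρ₀` the lens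
`V = φ.source ∩ φ⁻¹ {x : ‖x - φ a‖ < ρ' ∧ |f (φ⁻¹ x)| + k ‖x - φ a‖ < k ρ'/2}` (`φ = extChartAt I a`)
is an open neighbourhood of `a` contained in `W` in which `S ∩ V` is a Cauchy hypersurface of
`(V, g|_V, τ|_V)` (Hawking–Ellis 1973, §7.4, p. 234, Lemma 7.4.4 (1), Fig. 48: the regions `𝒰`
with achronal `∂𝒰 ∩ 𝒰̄₊`). The proof is that of
`exists_isCauchyHypersurface_restrict_of_timeFunction` (along a future timelike curve of `V` the
clock `f` increases at rate `≥ (c/2) ‖ẋ‖`, so an endless timelike curve of `V` crosses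
`{f = 0} = S` exactly once), with `k = c/4` and any `ρ' ≤ ρ/2` for the radius `ρ` below which all
local estimates hold. [cite: HawkingEllis1973CUP, §7.4, p. 234, Lemma 7.4.4 (1) and Fig. 48]
[cite: ONeillSemiRiemannian1983, Ch. 14, Thm. 14.38 and Lemma 14.43 (pp. 423–426)] -/
theorem exists_isCauchyHypersurface_restrict_lens_of_timeFunction [BoundarylessManifold I M]
    [FiniteDimensional ℝ E] (hn : 1 ≤ n)
    (hres : PseudoRiemannianMetric.contMDiff_restrict (I := I) (n := n) (M := M))
    (hτ : τ.contMDiff_restrict) {S : Set M} {a : M} {f : M → ℝ}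
    (hf : ContMDiffAt I 𝓘(ℝ, ℝ) 1 f a) (hfa : f a = 0)
    (hdf : ∀ v : TangentSpace I a, τ.IsFutureDirected v → (0 : ℝ) < mfderiv I 𝓘(ℝ, ℝ) f a v)
    (hS : ∀ᶠ q in 𝓝 a, q ∈ S ↔ f q = 0) {W : Set M} (hW : W ∈ 𝓝 a) :
    ∃ k : ℝ, 0 < k ∧ ∃ ρ₀ : ℝ, 0 < ρ₀ ∧ ∀ ρ' : ℝ, 0 < ρ' → ρ' ≤ ρ₀ →
      ∃ V : Opens M,
        (V : Set M) = (extChartAt I a).source ∩ (extChartAt I a) ⁻¹'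
          {x : E | ‖x - extChartAt I a a‖ < ρ' ∧
            |f ((extChartAt I a).symm x)| + k * ‖x - extChartAt I a a‖ < k * (ρ' / 2)} ∧
        a ∈ V ∧ (V : Set M) ⊆ W ∧
        (g.restrict hres V).IsCauchyHypersurface (τ.restrict hres hτ V) (Subtype.val ⁻¹' S) := by
  classical
  haveI : CompleteSpace E := FiniteDimensional.complete ℝ E
  -- notation and basic facts at `a`
  set φ := extChartAt I a with hφ
  set x₀ : E := φ a with hx₀
  set eT := trivializationAt E (TangentSpace I) a with heT
  have hx₀t : x₀ ∈ φ.target := mem_extChartAt_target a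
  have hx₀int : x₀ ∈ interior (range I) := BoundarylessManifold.isInteriorPoint (I := I) (M := M)
  have hrange : range I ∈ 𝓝 x₀ := mem_interior_iff_mem_nhds.mp hx₀int
  have htarget : φ.target ∈ 𝓝 x₀ := by
    have hint : x₀ ∈ interior (extChartAt I a).target :=
      ModelWithCorners.isInteriorPoint_iff.mp (BoundarylessManifold.isInteriorPoint (I := I))
    exact mem_interior_iff_mem_nhds.mp hint
  have hsymm₀ : φ.symm x₀ = a := extChartAt_to_inv a
  have hsrc₀ : a ∈ φ.source := mem_extChartAt_source a
  have hsrc_eq : φ.source = (chartAt H a).source := extChartAt_source I a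
  have hid : ∀ w : E, eT.symmL ℝ a w = w := symmL_trivializationAt_base a
  -- the clock in the chart: `F = f ∘ φ⁻¹` is `C¹` at `x₀`
  set F : E → ℝ := f ∘ φ.symm with hF_def
  have hF : ContDiffAt ℝ 1 F x₀ := by
    have hf' : ContMDiffAt I 𝓘(ℝ, ℝ) 1 f (φ.symm x₀) := by rw [hsymm₀]; exact hf
    have h1 : ContMDiffWithinAt 𝓘(ℝ, E) 𝓘(ℝ, ℝ) 1 F (range I) x₀ :=
      hf'.comp_contMDiffWithinAt x₀ (contMDiffWithinAt_extChartAt_symm_range a hx₀t)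
    exact (contMDiffWithinAt_iff_contDiffWithinAt.1 h1).contDiffAt hrange
  obtain ⟨f', u, hu, hf'c, hf'⟩ := contDiffAt_one_iff.1 hF
  set ℓ : E →L[ℝ] ℝ := f' x₀ with hℓ_def
  have hF0 : HasFDerivAt F ℓ x₀ := hf' x₀ (mem_of_mem_nhds hu)
  -- `ℓ` is the differential of `f` at `a` read in the chart
  have hℓ : ∀ w : E, ℓ w = mfderiv I 𝓘(ℝ, ℝ) f a w := by
    intro w
    have hfd : MDifferentiableAt I 𝓘(ℝ, ℝ) f a := hf.mdifferentiableAt (by simp)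
    have e1 : mfderiv I 𝓘(ℝ, ℝ) f a w =
        fderivWithin ℝ (writtenInExtChartAt I 𝓘(ℝ, ℝ) a f) (range I) (φ a) w :=
      DFunLike.congr_fun hfd.mfderiv w
    have hw : writtenInExtChartAt I 𝓘(ℝ, ℝ) a f = F := by
      funext y
      show (extChartAt 𝓘(ℝ, ℝ) (f a)) (f (φ.symm y)) = f (φ.symm y)
      rw [extChartAt_model_space_eq_id]
      rfl
    rw [e1, hw, fderivWithin_of_mem_nhds hrange, hF0.fderiv]
  -- `ℓ` is positive on the future causal cone of the coordinate metric at `x₀`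
  have hpos : ∀ v : E, v ≠ 0 → g.coordMetric a x₀ v v ≤ 0 →
      g.coordMetric a x₀ (τ.coordTime a x₀) v ≤ 0 → 0 < ℓ v := by
    intro v hv0 hvv hTv
    have hcaus : g.IsCausal (eT.symmL ℝ (φ.symm x₀) v) := (isCausal_symmL_iff hx₀t v).2 ⟨hvv, hv0⟩
    have hTv' : g.coordMetric a x₀ (τ.coordTime a x₀) v < 0 := by
      refine lt_of_le_of_ne hTv fun h0 ↦ ?_
      rw [coordMetric_coordTime_apply hx₀t] at h0
      exact g.val_ne_zero_of_isTimelike_of_isCausal (τ.isTimelike _) hcaus h0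
    have hfut : τ.IsFutureDirected (eT.symmL ℝ (φ.symm x₀) v) :=
      (isFutureDirected_symmL_iff hx₀t v).2 ⟨⟨hvv, hv0⟩, hTv'⟩
    rw [show (extChartAt I a).symm x₀ = a from hsymm₀, hid] at hfut
    rw [hℓ]
    exact hdf v hfut
  -- Step 1: the uniform cone constant
  obtain ⟨c, hc, m, hm, hcone⟩ :=
    PushUp.exists_cone_const_functional (g.coordMetric a x₀) (τ.coordTime a x₀) ℓ hpos
  -- Step 2: a chart radius `ρ` collecting all local requirements
  have hGc : ContinuousAt (g.coordMetric a) x₀ :=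
    ((g.contDiffOn_coordMetric hn a).continuousOn.continuousWithinAt hx₀t).continuousAt htarget
  have hTc : ContinuousAt (τ.coordTime a) x₀ := (τ.continuousOn_coordTime hn a).continuousAt htarget
  have hGTc : ContinuousAt (fun x ↦ g.coordMetric a x (τ.coordTime a x)) x₀ := hGc.clm_apply hTc
  have hf'c₀ : ContinuousAt f' x₀ := hf'c.continuousAt hu
  have hsymmc : ContinuousAt φ.symm x₀ := continuousAt_extChartAt_symm a
  have hW' : W ∈ 𝓝 (φ.symm x₀) := by rw [hsymm₀]; exact hW
  have hS' : {q | q ∈ S ↔ f q = 0} ∈ 𝓝 (φ.symm x₀) := by rw [hsymm₀]; exact hS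
  obtain ⟨ρ, hρ, hball⟩ : ∃ ρ > 0, ∀ x : E, ‖x - x₀‖ < ρ → x ∈ φ.target ∧ x ∈ u ∧
      ‖g.coordMetric a x - g.coordMetric a x₀‖ < m ∧
      ‖g.coordMetric a x (τ.coordTime a x) - g.coordMetric a x₀ (τ.coordTime a x₀)‖ < m ∧
      ‖f' x - ℓ‖ ≤ c / 2 ∧ φ.symm x ∈ W ∧ (φ.symm x ∈ S ↔ f (φ.symm x) = 0) := by
    have h1 : ∀ᶠ x in 𝓝 x₀, ‖g.coordMetric a x - g.coordMetric a x₀‖ < m := by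
      obtain ⟨δ', hδ', hδ''⟩ := (NormedAddCommGroup.tendsto_nhds_nhds (f := g.coordMetric a)
        (x := x₀) (y := g.coordMetric a x₀)).1 hGc.tendsto m hm
      exact Metric.eventually_nhds_iff.2 ⟨δ', hδ', fun y hy ↦ hδ'' y (by rwa [← dist_eq_norm])⟩
    have h2 : ∀ᶠ x in 𝓝 x₀, ‖g.coordMetric a x (τ.coordTime a x) -
        g.coordMetric a x₀ (τ.coordTime a x₀)‖ < m := by
      obtain ⟨δ', hδ', hδ''⟩ := (NormedAddCommGroup.tendsto_nhds_nhds
        (f := fun x ↦ g.coordMetric a x (τ.coordTime a x)) (x := x₀)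
        (y := g.coordMetric a x₀ (τ.coordTime a x₀))).1 hGTc.tendsto m hm
      exact Metric.eventually_nhds_iff.2 ⟨δ', hδ', fun y hy ↦ hδ'' y (by rwa [← dist_eq_norm])⟩
    have h3 : ∀ᶠ x in 𝓝 x₀, ‖f' x - ℓ‖ ≤ c / 2 := by
      obtain ⟨δ', hδ', hδ''⟩ := (NormedAddCommGroup.tendsto_nhds_nhds (f := f') (x := x₀)
        (y := f' x₀)).1 hf'c₀.tendsto (c / 2) (by positivity)
      exact Metric.eventually_nhds_iff.2
        ⟨δ', hδ', fun y hy ↦ (hδ'' y (by rwa [← dist_eq_norm])).le⟩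
    have h4 : ∀ᶠ x in 𝓝 x₀, φ.symm x ∈ W := hsymmc.preimage_mem_nhds hW'
    have h5 : ∀ᶠ x in 𝓝 x₀, (φ.symm x ∈ S ↔ f (φ.symm x) = 0) := hsymmc.preimage_mem_nhds hS'
    have ht' : ∀ᶠ x in 𝓝 x₀, x ∈ φ.target := htarget
    have hu' : ∀ᶠ x in 𝓝 x₀, x ∈ u := hu
    obtain ⟨ρ, hρ, hρ'⟩ := Metric.eventually_nhds_iff.1
      ((((ht'.and hu').and (h1.and h2)).and (h3.and (h4.and h5))))
    refine ⟨ρ, hρ, fun x hx ↦ ?_⟩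
    have h := hρ' (y := x) (by rw [dist_eq_norm]; exact hx)
    exact ⟨h.1.1.1, h.1.1.2, h.1.2.1, h.1.2.2, h.2.1, h.2.2.1, h.2.2.2⟩
  -- consequences on the ball
  have hFd : ∀ x : E, ‖x - x₀‖ < ρ → HasFDerivAt F (f' x) x := fun x hx ↦ hf' x (hball x hx).2.1
  -- Step 3: the slope `k`, the admissible radii `ρ' ≤ ρ / 2`, the lens `Kset` and the open set `V`
  refine ⟨c / 4, by positivity, ρ / 2, by positivity, fun ρ' hρ'pos hρ'le ↦ ?_⟩
  set k : ℝ := c / 4 with hk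
  have hkpos : 0 < k := by positivity
  have hρ'ρ : ρ' < ρ := by linarith
  set δ : ℝ := k * (ρ' / 2) with hδ
  have hδpos : 0 < δ := by positivity
  set Q : E → ℝ := fun x ↦ |F x| + k * ‖x - x₀‖ with hQ
  set Kset : Set E := {x | ‖x - x₀‖ < ρ' ∧ Q x < δ} with hKset
  have hKsub : ∀ x ∈ Kset, ‖x - x₀‖ < ρ' / 2 := by
    rintro x ⟨-, hx⟩
    have h1 : k * ‖x - x₀‖ < k * (ρ' / 2) := by
      have : k * ‖x - x₀‖ ≤ Q x := by simp only [hQ]; linarith [abs_nonneg (F x)]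
      linarith
    exact lt_of_mul_lt_mul_left h1 hkpos.le
  have hKρ : ∀ x ∈ Kset, ‖x - x₀‖ < ρ := fun x hx ↦ (hKsub x hx).trans (by linarith)
  have hQc : ContinuousOn Q (Metric.ball x₀ ρ') := by
    intro x hx
    have hx' : ‖x - x₀‖ < ρ := by
      rw [Metric.mem_ball, dist_eq_norm] at hx; exact hx.trans hρ'ρ
    exact (((hFd x hx').continuousAt.abs).add
      ((continuous_const.mul (continuous_id.sub continuous_const).norm).continuousAt)).continuousWithinAt
  have hKopen : IsOpen Kset := by
    have hKeq : Kset = Metric.ball x₀ ρ' ∩ Q ⁻¹' Iio δ := by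
      ext x
      simp only [hKset, mem_setOf_eq, mem_inter_iff, Metric.mem_ball, dist_eq_norm, mem_preimage,
        mem_Iio]
    rw [hKeq]
    exact hQc.isOpen_inter_preimage Metric.isOpen_ball isOpen_Iio
  have hx₀K : x₀ ∈ Kset := by
    refine ⟨by rw [sub_self, norm_zero]; exact hρ'pos, ?_⟩
    show |F x₀| + k * ‖x₀ - x₀‖ < δ
    have : F x₀ = 0 := by show f (φ.symm x₀) = 0; rw [hsymm₀]; exact hfa
    rw [this, sub_self, norm_zero, abs_zero, mul_zero, add_zero]
    exact hδpos
  set V : Opens M := ⟨φ.source ∩ φ ⁻¹' Kset,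
    (continuousOn_extChartAt a).isOpen_inter_preimage (isOpen_extChartAt_source a) hKopen⟩ with hV
  have hmemV : ∀ {q : M}, q ∈ V ↔ q ∈ φ.source ∧ φ q ∈ Kset := fun {q} ↦ Iff.rfl
  refine ⟨V, rfl, hmemV.2 ⟨hsrc₀, hx₀K⟩, fun q hq ↦ ?_, ?_⟩
  · -- `V ⊆ W`
    obtain ⟨hq1, hq2⟩ := hmemV.1 hq
    have h := (hball (φ q) (hKρ _ hq2)).2.2.2.2.2.1
    rwa [φ.left_inv hq1] at h
  -- Step 4: the Cauchy property
  intro γ J hγ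
  obtain ⟨hJ, hγt, hγf, hγp⟩ := hγ
  set γM : ℝ → M := Subtype.val ∘ γ with hγM_def
  have hγM : g.IsFutureTimelikeCurveOn τ γM J :=
    (isFutureTimelikeCurveOn_restrict_iff g τ hres hτ V).1 hγt
  have hγV : ∀ s, γM s ∈ φ.source ∧ φ (γM s) ∈ Kset := fun s ↦ hmemV.1 (γ s).2
  -- the coordinate curve and its velocity
  set xc : ℝ → E := fun s ↦ φ (γM s) with hxc
  set wc : ℝ → E := fun s ↦ eT.continuousLinearMapAt ℝ (γM s) (velocity I γM s) with hwc
  have hxcK : ∀ s, xc s ∈ Kset := fun s ↦ (hγV s).2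
  have hxcρ : ∀ s, ‖xc s - x₀‖ < ρ := fun s ↦ hKρ _ (hxcK s)
  have hleft : ∀ s, φ.symm (xc s) = γM s := fun s ↦ φ.left_inv (hγV s).1
  have hderiv : ∀ s ∈ J, HasDerivAt xc (wc s) s := fun s hs ↦
    hasDerivAt_extChartAt_comp_continuousLinearMapAt (p := a) (hγM s hs).1
      (by rw [← hsrc_eq]; exact (hγV s).1)
  have hcoord : ∀ s ∈ J, (g.coordMetric a (xc s) (wc s) (wc s) ≤ 0 ∧ wc s ≠ 0) ∧
      g.coordMetric a (xc s) (τ.coordTime a (xc s)) (wc s) < 0 := fun s hs ↦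
    (isFutureDirected_iff_coord (τ := τ) (p := a) (by rw [← hsrc_eq]; exact (hγV s).1)
      (velocity I γM s)).1 (hγM s hs).2.2
  have hcone' : ∀ s ∈ J, c * ‖wc s‖ ≤ ℓ (wc s) := fun s hs ↦ by
    obtain ⟨-, -, hGx, hGTx, -⟩ := hball (xc s) (hxcρ s)
    exact hcone _ _ hGx hGTx (wc s) (hcoord s hs).1.1 (hcoord s hs).2
  -- the clock along the curve
  set h : ℝ → ℝ := fun s ↦ F (xc s) with hh_def
  have hhf : ∀ s, h s = f (γM s) := fun s ↦ by
    show f (φ.symm (xc s)) = f (γM s); rw [hleft]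
  have hh : ∀ s ∈ J, HasDerivAt h (f' (xc s) (wc s)) s := fun s hs ↦
    (hFd (xc s) (hxcρ s)).comp_hasDerivAt s (hderiv s hs)
  have hrate : ∀ s ∈ J, c / 2 * ‖wc s‖ ≤ f' (xc s) (wc s) := fun s hs ↦ by
    have h1 := hcone' s hs
    have h2 : ‖f' (xc s) - ℓ‖ ≤ c / 2 := (hball (xc s) (hxcρ s)).2.2.2.2.1
    have h3 : |(f' (xc s) - ℓ) (wc s)| ≤ c / 2 * ‖wc s‖ := by
      rw [← Real.norm_eq_abs]
      exact ((f' (xc s) - ℓ).le_opNorm (wc s)).trans (mul_le_mul_of_nonneg_right h2 (norm_nonneg _))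
    have h4 : (f' (xc s) - ℓ) (wc s) = f' (xc s) (wc s) - ℓ (wc s) := rfl
    rw [h4] at h3
    linarith [neg_abs_le (f' (xc s) (wc s) - ℓ (wc s))]
  have hratepos : ∀ s ∈ J, 0 < f' (xc s) (wc s) := fun s hs ↦ by
    have h1 : 0 < ‖wc s‖ := norm_pos_iff.2 (hcoord s hs).1.2
    have := hrate s hs
    nlinarith
  -- the clock is strictly increasing along `J`
  have hcont : ContinuousOn h J := fun s hs ↦ (hh s hs).continuousAt.continuousWithinAt
  have hmono : StrictMonoOn h J := by
    refine strictMonoOn_of_deriv_pos hJ.convex hcont fun s hs ↦ ?_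
    have hs' : s ∈ J := interior_subset hs
    rw [(hh s hs').deriv]
    exact hratepos s hs'
  have hJne : J.Nonempty := hγf.1
  -- continuity of `F` on the closed half-ball
  have hFc : ContinuousOn F (Metric.closedBall x₀ (ρ' / 2)) := fun x hx ↦ by
    have hx' : ‖x - x₀‖ < ρ := by
      rw [Metric.mem_closedBall, dist_eq_norm] at hx; linarith
    exact (hFd x hx').continuousAt.continuousWithinAt
  have hFc' : ContinuousOn (fun x ↦ -F x) (Metric.closedBall x₀ (ρ' / 2)) := hFc.neg
  have hk2 : 2 * k ≤ c / 2 := by rw [hk]; linarith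
  -- a limit point of the coordinate curve inside the half-closed lens gives an endpoint in `V`
  have hlim : ∀ e : E, ‖e - x₀‖ ≤ ρ' / 2 → |F e| + k * ‖e - x₀‖ < δ →
      ∃ hq : φ.symm e ∈ V, ∀ {l : Filter J}, Tendsto (fun s : J ↦ xc s) l (𝓝 e) →
        Tendsto (fun s : J ↦ γ s) l (𝓝 ⟨φ.symm e, hq⟩) := by
    intro e he1 he2
    have heK : e ∈ Kset := ⟨he1.trans_lt (by linarith), he2⟩
    have het : e ∈ φ.target := (hball e (hKρ e heK)).1
    have hq : φ.symm e ∈ V := hmemV.2 ⟨φ.map_target het, by rw [φ.right_inv het]; exact heK⟩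
    refine ⟨hq, fun {l} hl ↦ ?_⟩
    have h1 : Tendsto (fun s : J ↦ γM s) l (𝓝 (φ.symm e)) := by
      have h2 := ((continuousAt_extChartAt_symm'' het).tendsto).comp hl
      exact h2.congr fun s ↦ hleft s
    rw [nhds_subtype_eq_comap, tendsto_comap_iff]
    exact h1
  -- future side: the clock becomes nonnegative
  have hfut : ∃ s ∈ J, 0 ≤ h s := by
    rcases exists_clock_nonneg_or_hasFutureEndpoint hJ hJne (half_pos hc) hkpos.le hk2
      (x₀ := x₀) (Φ := F) (δ := δ) hFc hderiv hh hrate (fun s _ ↦ rfl)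
      (fun s _ ↦ ⟨hKsub _ (hxcK s), (hxcK s).2⟩) with h1 | ⟨e, he1, he2, he3⟩
    · exact h1
    · exfalso
      obtain ⟨hq, hT⟩ := hlim e he1 he2
      exact hγf.2 ⟨φ.symm e, hq⟩ (hT he3)
  -- past side: the clock becomes nonpositive (the reversed curve, clock `-f`)
  have hpast : ∃ s ∈ J, h s ≤ 0 := by
    have hJ' : (Neg.neg ⁻¹' J).OrdConnected := ordConnected_preimage_neg hJ
    have hJne' : (Neg.neg ⁻¹' J).Nonempty := by
      obtain ⟨s, hs⟩ := hJne; exact ⟨-s, by simpa using hs⟩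
    have hx' : ∀ s ∈ Neg.neg ⁻¹' J, HasDerivAt (fun s ↦ xc (-s)) (-wc (-s)) s := fun s hs ↦ by
      have h1 := (hderiv (-s) hs).scomp s (hasDerivAt_neg s)
      rw [neg_one_smul] at h1
      exact h1
    have hh' : ∀ s ∈ Neg.neg ⁻¹' J, HasDerivAt (fun s ↦ -h (-s)) (f' (xc (-s)) (wc (-s))) s :=
      fun s hs ↦ by
        have h1 := ((hh (-s) hs).comp s (hasDerivAt_neg s)).neg
        rw [mul_neg_one, neg_neg] at h1
        exact h1
    have hw' : ∀ s ∈ Neg.neg ⁻¹' J, c / 2 * ‖-wc (-s)‖ ≤ f' (xc (-s)) (wc (-s)) := fun s hs ↦ by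
      rw [norm_neg]; exact hrate (-s) hs
    rcases exists_clock_nonneg_or_hasFutureEndpoint hJ' hJne' (half_pos hc) hkpos.le hk2
      (x₀ := x₀) (Φ := fun x ↦ -F x) (δ := δ) hFc' hx' hh' hw' (fun s _ ↦ rfl)
      (fun s _ ↦ ⟨hKsub _ (hxcK (-s)), by rw [abs_neg]; exact (hxcK (-s)).2⟩)
      with ⟨s, hs, h1⟩ | ⟨e, he1, he2, he3⟩
    · exact ⟨-s, hs, by linarith⟩
    · exfalso
      rw [abs_neg] at he2
      obtain ⟨hq, hT⟩ := hlim e he1 he2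
      have he4 : HasPastEndpoint xc J e := by
        have h5 := (hasPastEndpoint_comp_neg_iff (γ := fun s ↦ xc (-s)) (s := Neg.neg ⁻¹' J)
          (p := e)).2 he3
        have hs : Neg.neg ⁻¹' (Neg.neg ⁻¹' J) = J := by ext t; simp
        simp only [neg_neg] at h5
        rwa [hs] at h5
      exact hγp.2 ⟨φ.symm e, hq⟩ (hT he4)
  -- the crossing, by the intermediate value theorem, and its uniqueness
  obtain ⟨s₁, hs₁, h₁⟩ := hfut
  obtain ⟨s₂, hs₂, h₂⟩ := hpast
  have hsub : uIcc s₂ s₁ ⊆ J := hJ.uIcc_subset hs₂ hs₁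
  obtain ⟨t, ht, ht0⟩ : ∃ t ∈ uIcc s₂ s₁, h t = 0 :=
    intermediate_value_uIcc (hcont.mono hsub) ⟨inf_le_left.trans h₂, h₁.trans le_sup_right⟩
  have htJ : t ∈ J := hsub ht
  have hslice : ∀ s, (γM s ∈ S ↔ f (γM s) = 0) := fun s ↦ by
    have h := (hball (xc s) (hxcρ s)).2.2.2.2.2.2
    rwa [hleft] at h
  refine ⟨t, ⟨htJ, (hslice t).2 (by rw [← hhf]; exact ht0)⟩, fun t' ht' ↦ ?_⟩
  have h0 : h t' = 0 := by rw [hhf]; exact (hslice t').1 ht'.2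
  exact hmono.injOn ht'.1 htJ (h0.trans ht0.symm)

/-- **Local Cauchy lenses in a chart domain, with their shape.** For a time-oriented Lorentzian
metric on an open subset `T` of a finite-dimensional normed space `E` (where the extended chart at
any point is the inclusion `T ⊆ E`, `OpensChart.extChartAt_coe`), a point `a ∈ T` and `f : T → ℝ`
of class `C¹` at `a` with `f a = 0` and differential positive on the future causal cone at `a`,
and `S ⊆ T` agreeing with `{f = 0}` near `a`: there are `k > 0` and `ρ₀ > 0` such that for every
`0 < ρ' ≤ ρ₀` the lens `V = {x ∈ T : ‖x - a‖ < ρ' ∧ |f x| + k ‖x - a‖ < k ρ'/2}` is an open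
neighbourhood of `a` inside the prescribed `W` in which `S ∩ V` is a Cauchy hypersurface of
`(V, g|_V, τ|_V)`. Hawking–Ellis 1973, §7.4, p. 234, Lemma 7.4.4 (1), Fig. 48.
[cite: HawkingEllis1973CUP, §7.4, p. 234, Lemma 7.4.4 (1) and Fig. 48] -/
theorem exists_isCauchyHypersurface_restrict_lens_opens [FiniteDimensional ℝ E] {T : Opens E}
    {g : LorentzianMetric 𝓘(ℝ, E) n T} {τ : TimeOrientation g} (hn : 1 ≤ n)
    (hres : PseudoRiemannianMetric.contMDiff_restrict (I := 𝓘(ℝ, E)) (n := n) (M := T))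
    (hτ : τ.contMDiff_restrict) {S : Set T} {a : T} {f : T → ℝ}
    (hf : ContMDiffAt 𝓘(ℝ, E) 𝓘(ℝ, ℝ) 1 f a) (hfa : f a = 0)
    (hdf : ∀ v : TangentSpace 𝓘(ℝ, E) a, τ.IsFutureDirected v →
      (0 : ℝ) < mfderiv 𝓘(ℝ, E) 𝓘(ℝ, ℝ) f a v)
    (hS : ∀ᶠ q in 𝓝 a, q ∈ S ↔ f q = 0) {W : Set T} (hW : W ∈ 𝓝 a) :
    ∃ k : ℝ, 0 < k ∧ ∃ ρ₀ : ℝ, 0 < ρ₀ ∧ ∀ ρ' : ℝ, 0 < ρ' → ρ' ≤ ρ₀ →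
      ∃ V : Opens T,
        (∀ x : T, x ∈ V ↔
          ‖(x : E) - a‖ < ρ' ∧ |f x| + k * ‖(x : E) - a‖ < k * (ρ' / 2)) ∧
        a ∈ V ∧ (V : Set T) ⊆ W ∧
        (g.restrict hres V).IsCauchyHypersurface (τ.restrict hres hτ V) (Subtype.val ⁻¹' S) := by
  obtain ⟨k, hk, ρ₀, hρ₀, H⟩ :=
    exists_isCauchyHypersurface_restrict_lens_of_timeFunction hn hres hτ hf hfa hdf hS hW
  refine ⟨k, hk, ρ₀, hρ₀, fun ρ' hρ' hρ'le ↦ ?_⟩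
  obtain ⟨V, hVeq, haV, hVW, hC⟩ := H ρ' hρ' hρ'le
  refine ⟨V, fun x ↦ ?_, haV, hVW, hC⟩
  have hsymm : (extChartAt 𝓘(ℝ, E) a).symm (x : E) = x := by
    have h := (extChartAt 𝓘(ℝ, E) a).left_inv (x := x)
      (by rw [OpensChart.extChartAt_source]; exact mem_univ _)
    rwa [OpensChart.extChartAt_apply] at h
  change x ∈ (V : Set T) ↔ _
  rw [hVeq]
  simp only [mem_inter_iff, mem_preimage, mem_setOf_eq, OpensChart.extChartAt_source, mem_univ,
    true_and, OpensChart.extChartAt_apply, hsymm]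

end LorentzianMetric

end Literature.Geometry.Lorentzian

end
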